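import Summits.QuantumFields.BalabanUV.Beta.FP.PeriodisedSymCoarseWardContactTwo

/-!
# `BalabanUV.Beta.FP.PeriodisedSymCoarseWardBiMember` — road «FP» for binder row D1, ROUTE T, RULING R-FP-63 (journal [D1P3-G25-ONLINE]): **THE `d2′` DEFECT IN
# CLOSED FORM — `Q₂₀·Db₂′ = Q₂₂″(h,h)·D̄` — AND ROW `d2` VERBATIM FOR THE PURE BI-MEMBER**

WHY.  leaf-02 g23's T4 `PeriodisedSymCoarseWardContactTwo.torus_d2_sym_weighted` (p351786) computes the left-hand side of U21's displayed coarse covariance row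
`d2 : Q₂₂ h h * Dbar + 2 • (Q₂₁ h * Db₁) + Q₂₀ * Db₂ = 0` from the objects of record and finds it equal NOT to `0` but to `Q₂₀ * Db₂′`,
`Db₂′((p̄,m),t̄) = c_j·((Q₁₁ h)·h)(p̄,m)·[t̄ = p̄ + e_m]` (FINDING F-leaf02-g23-1, adopted by RULING R-FP-62: the coarse generator's order-2 slot is the jet along
the transported CURVE, `Db₂ − Db₂′`).  Engine C was asked (D2DET) whether `Q₂₀ * Db₂′` is STRUCTURALLY zero.  This file answers from the tree: by leaf-02
g21's row `d1` for an ARBITRARY column in the `Q₁₀` slot (`PeriodisedSymCoarseWardContact.torus_d1_symVhSAt` — i.e. PER COARSE WEIGHT `q`), read at the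
coarse weight `q₂ := (Q₁₁ h)·h`, **`Q₂₀ * Db₂′ = Q₂₂″ h h * Dbar`** where `Q₂₂″(w,w′) := Σ_{a′} (θ_j·Σ_{b′} Q₁₁ w a′ b′·w′ b′) • Q₂₁mem^{a′}` is EXACTLY the
second summand of U21's `hQ₂₂` (the average map's second-jet member).  Hence U21's `d2` holds IN ITS DISPLAYED SHAPE `… = 0` for the PURE BI-MEMBER
`Q₂₂′ := Q₂₂ − Q₂₂″` with the PURE `Db₂` of row `c2` (`torus_d2_sym_bimember`) — the three cuts (R-FP-62 (ii)'s `Db₂ − Db₂′` with full `Q₂₂`; `Q₂₂′` with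
pure `Db₂`; T4 as typed) are ONE identity, and the object the door's proof chain must carry wherever it consumes `Q₂₂·D̄` through `d2` is the ONE named matrix
`Q₂₂″ h h * Dbar = Q₂₀ * Db₂′` (delta (Δ6) of the door of record, restated).  D2DET (d3) is thereby «not structurally zero»: the defect is the `d1`-row's first
term for the weight `q₂`, entrywise `s_j·#B·c_{j+1}·Σ_{a′ : tip a′ = t̄} q₂(a′)·Q₂₀(α,a′)`.

WHAT ([folklore] finite matrix algebra BY NAME over leaf-02's two landed theorems; no `def`, no `def … : Prop`, nothing cited, 0 sorry; `d + 1 = 4`):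
* §1 **`torus_Q20_mul_tipRow_eq_member_mul_Dbar`** — for ANY coarse weight `q`: `Q₂₀ * of (a t̄ ↦ c_j·q a·[t̄ = tip a]) = (Σ_{a′} (θ_j·q a′) • Q₂₁mem^{a′}) * Dbar`
  (`torus_d1_symVhSAt` at the constant-column matrix `of (a′ _ ↦ q a′)`).
* §2 **`torus_Q20_mul_Db2'_eq_member_mul_Dbar`** — at T4's letters (`Q₁₁`, `h` FREE): `Q₂₀ * Db₂′ = Q₂₂″ h h * Dbar`.
* §3 **`torus_d2_sym_bimember`** — T4's binders VERBATIM except that the order-2 coarse insertion table is the PURE BI-MEMBER `Q₂₂′` (`hQ₂₂′` = the first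
  summand of U21's `hQ₂₂`): `Q₂₂′ h h * Dbar + 2 • (Q₂₁ h * Db₁) + Q₂₀ * Db₂ = 0`.

HONEST DEPENDENCY (page 1, mandatory): continuum YM on T⁴ ⇐ BetaPertH ∧ nine spine estimates (0/9 proved); BetaPertH ⇐ (D1) ∧ (D4) ∧ CAP+tail;
G-an2-4 gates asym, D1 and NE2/3/4.  HONEST FRAMING (cell contract, verbatim): «discharging `BetaPertH` makes Bałaban's UV stability UNCONDITIONAL —
a real constructive-QFT result; it is NOT the continuum limit and NOT the Clay problem.»  ABSOLUTE RULE (cell charter, verbatim): «No internally-minted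
statement may enter as a cited fact. Every hypothesis is either kernel-proved in this package or a verbatim quotation of a PUBLISHED theorem with page
reference. The manuscript(s) under audit are NOT citable for their own disputed steps — they are the thing under adjudication; programme-internal
(2001/route/tribunal) claims are never citable.»  Nothing of the dictionary ∕ of Bałaban's asserted (the bindings `hQ₂₀ hQ₂₁ hQ₂₂′ hDbar hDb₁ hDb₂` are
DISPLAYED defining equations); 0 estimates; 0∕4 row-D1 binders (hW, hR, D1Tel, D1Rep); NOT (T-ID), NOT (J-a) complete, NOT SDF, NOT D1, NOT BetaPertH, NOT
continuum, NOT Clay.  Road «FP» OWNER, b2b-balaban-beta-d1-p3 gen 25, 2026-08-23.  No existing file touched.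
-/

noncomputable section

open scoped BigOperators

namespace Summit.QuantumFields.BalabanUV.Beta.FP.PeriodisedSymCoarseWardBiMember

open Finset Matrix
open Literature.MathematicalPhysics.QuantumFieldTheory.Balaban1983to89
open Literature.MathematicalPhysics.QuantumFieldTheory.Balaban1983to89.Beta
open B4TorusKernel.MultiPeriod (translate)
open B5Prop11Plancherel (fine)
open B6Lemma24Torus (pbox mem_pbox)
open ExpKernelCalculus (MKer)
open AffineAveraging (Site box toSite unitVec)
open AveragingContoursRooted (ctr ctrOff ctrOff_mem_box)
open OneStepResolventKernel (Fib)
open Summit.QuantumFields.BalabanUV.Beta.BorderedHessian (stepScale stepScale_ne_zero)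
open Summit.QuantumFields.BalabanUV.Beta.DshAn1 (Dsh)
open Summit.QuantumFields.BalabanUV.Beta.SymAveragingHessianCounts (symVhSAt)
open Summit.QuantumFields.BalabanUV.Beta.SymShiftedSpread (bhKStepSh)
open Summit.QuantumFields.BalabanUV.Beta.SymSecondOrderTablesAn1 (symVh₂SAn1)
open Summit.QuantumFields.BalabanUV.Beta.FP.KernelPeriodisationFib (Idx perF)
open Summit.QuantumFields.BalabanUV.Beta.FP.KernelPeriodisationFibLoc (dper)
open Summit.QuantumFields.BalabanUV.Beta.FP.TorusGaugeCovariance (tdelta tgrad)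
open Summit.QuantumFields.BalabanUV.Beta.FP.TorusCombRows (Res)
open Summit.QuantumFields.BalabanUV.Beta.FP.PeriodisedSymCoarseWardContact (torus_d1_symVhSAt)
open Summit.QuantumFields.BalabanUV.Beta.FP.PeriodisedSymCoarseWardContactTwo (torus_d2_sym_weighted)

variable (M' : Fin (3 + 1) → ℕ) [∀ μ, NeZero (M' μ)] {Lc : ℕ} [NeZero Lc]

/-! ## §1 The tip-row identity for an arbitrary coarse weight -/

/-- [folklore] **`Q₂₀ · (c_j·q·[t̄ = tip]) = (Σ_{a′} (θ_j·q a′) • Q₂₁mem^{a′}) · D̄` FOR EVERY COARSE WEIGHT `q`** — leaf-02's row `d1`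
(`PeriodisedSymCoarseWardContact.torus_d1_symVhSAt`, stated for an arbitrary matrix in the `Q₁₀` slot and an arbitrary fine bond) read at the constant-column
matrix `of (a′ _ ↦ q a′)`: the level-`(j+1)` one-step rows against a tip-type generator row weighted by `q` equal the first-order averaging members weighted by
`θ_j·q` against the coarse pure-gauge columns `D̄`.  `Lc ∣ M′`; multiplier rows `α ↦ (pμ′ α, inr (mμ′ α))`, ANY presentation; `hQ₂₀`, `hDbar` = U21's. -/
theorem torus_Q20_mul_tipRow_eq_member_mul_Dbar (hM' : ∀ i, Lc ∣ M' i) (j : ℕ) {κI : Type*} (pμ' : κI → ↥(pbox M')) (mμ' : κI → Fin (3 + 1))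
    {Q₂₀ : Matrix κI (↥(pbox M') × Fin (3 + 1)) ℝ}
    (hQ₂₀ : Q₂₀ = (perF M' (bhKStepSh 3 Lc (Dsh Lc) (j + 1))).submatrix (fun a : κI => ((pμ' a, Sum.inr (mμ' a)) : Idx M' (Fib 3)))
        (fun b : ↥(pbox M') × Fin (3 + 1) => ((b.1, Sum.inl b.2) : Idx M' (Fib 3))))
    {Dbar : Matrix (↥(pbox M') × Fin (3 + 1)) (Res (ctr (3 + 1) Lc) Lc M') ℝ}
    (hDbar : Dbar = Matrix.of fun (a : ↥(pbox M') × Fin (3 + 1)) (t : Res (ctr (3 + 1) Lc) Lc M') =>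
        stepScale 3 Lc j * (((box (3 + 1) Lc).card : ℝ) * tgrad M' (a.1, Sum.inl a.2) t.1))
    (q : ↥(pbox M') × Fin (3 + 1) → ℝ) :
    Q₂₀ * Matrix.of (fun (a : ↥(pbox M') × Fin (3 + 1)) (t : Res (ctr (3 + 1) Lc) Lc M') =>
          (((Lc : ℝ) ^ (3 + 1) * stepScale 3 Lc j)⁻¹) * q a * tdelta M' ((a.1 : Site (3 + 1)) + unitVec a.2) t.1)
      = (∑ a' : ↥(pbox M') × Fin (3 + 1), (stepScale 3 Lc (j + 1) / (stepScale 3 Lc j ^ 2 * ((box (3 + 1) Lc).card : ℝ)) * q a') •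
          (perF M' (dper M' (symVhSAt (ctr (3 + 1) Lc) 3 Lc rfl a'.2 (a'.1 : Site (3 + 1))))).submatrix (fun a : κI => ((pμ' a, Sum.inr (mμ' a)) : Idx M' (Fib 3)))
            (fun b : ↥(pbox M') × Fin (3 + 1) => ((b.1, Sum.inl b.2) : Idx M' (Fib 3)))) * Dbar := by
  -- one fine torus bond (the origin, direction 0): the identity below does not depend on it
  have h0 : (0 : Site (3 + 1)) ∈ pbox (fine Lc M') :=
    mem_pbox.2 fun i => by
      simp only [Pi.zero_apply]
      exact ⟨le_rfl, by exact_mod_cast Nat.pos_of_ne_zero (NeZero.ne (fine Lc M' i))⟩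
  set b₀ : ↥(pbox (fine Lc M')) × Fin (3 + 1) := (⟨0, h0⟩, 0) with hb₀
  have h := torus_d1_symVhSAt M' hM' j pμ' mμ' hQ₂₀ hDbar
    (Matrix.of fun (a' : ↥(pbox M') × Fin (3 + 1)) (_ : ↥(pbox (fine Lc M')) × Fin (3 + 1)) => q a') b₀
  simp only [Matrix.of_apply] at h
  have hneg : (Matrix.of fun (a : ↥(pbox M') × Fin (3 + 1)) (t : Res (ctr (3 + 1) Lc) Lc M') =>
        -((((Lc : ℝ) ^ (3 + 1) * stepScale 3 Lc j)⁻¹) * q a * tdelta M' ((a.1 : Site (3 + 1)) + unitVec a.2) t.1))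
      = -(Matrix.of fun (a : ↥(pbox M') × Fin (3 + 1)) (t : Res (ctr (3 + 1) Lc) Lc M') =>
          (((Lc : ℝ) ^ (3 + 1) * stepScale 3 Lc j)⁻¹) * q a * tdelta M' ((a.1 : Site (3 + 1)) + unitVec a.2) t.1) := by
    ext a t
    simp only [Matrix.of_apply, Matrix.neg_apply]
  rw [hneg, Matrix.mul_neg, ← sub_eq_add_neg, sub_eq_zero] at h
  exact h.symm

/-! ## §2 At T4's letters: the `d2′` defect IS the second-jet member against the coarse pure-gauge columns -/

/-- [folklore] **`Q₂₀ * Db₂′ = Q₂₂″ h h * Dbar`** (RULING R-FP-63 (i), closed form of T4's right-hand side).  `Q₁₁` and `h` are FREE (only the coarse weight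
`q₂ a = Σ_{b′} Q₁₁ h a b′ · h b′` enters); `Db₂′` is `torus_d2_sym_weighted`'s right-hand matrix VERBATIM; `Q₂₂″ h h` is the SECOND summand of U21's `hQ₂₂`
VERBATIM (the average map's second-jet member `Σ_{a′} (θ_j·((Q₁₁ h)·h) a′) • Q₂₁mem^{a′}`). -/
theorem torus_Q20_mul_Db2'_eq_member_mul_Dbar (hM' : ∀ i, Lc ∣ M' i) (j : ℕ) {κI : Type*} (pμ' : κI → ↥(pbox M')) (mμ' : κI → Fin (3 + 1))
    (h : ↥(pbox (fine Lc M')) × Fin (3 + 1) → ℝ)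
    (Q₁₁ : (↥(pbox (fine Lc M')) × Fin (3 + 1) → ℝ) → Matrix (↥(pbox M') × Fin (3 + 1)) (↥(pbox (fine Lc M')) × Fin (3 + 1)) ℝ)
    {Q₂₀ : Matrix κI (↥(pbox M') × Fin (3 + 1)) ℝ}
    (hQ₂₀ : Q₂₀ = (perF M' (bhKStepSh 3 Lc (Dsh Lc) (j + 1))).submatrix (fun a : κI => ((pμ' a, Sum.inr (mμ' a)) : Idx M' (Fib 3)))
        (fun b : ↥(pbox M') × Fin (3 + 1) => ((b.1, Sum.inl b.2) : Idx M' (Fib 3))))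
    {Dbar : Matrix (↥(pbox M') × Fin (3 + 1)) (Res (ctr (3 + 1) Lc) Lc M') ℝ}
    (hDbar : Dbar = Matrix.of fun (a : ↥(pbox M') × Fin (3 + 1)) (t : Res (ctr (3 + 1) Lc) Lc M') =>
        stepScale 3 Lc j * (((box (3 + 1) Lc).card : ℝ) * tgrad M' (a.1, Sum.inl a.2) t.1)) :
    Q₂₀ * Matrix.of (fun (a : ↥(pbox M') × Fin (3 + 1)) (t : Res (ctr (3 + 1) Lc) Lc M') =>
          (((Lc : ℝ) ^ (3 + 1) * stepScale 3 Lc j)⁻¹) * (∑ b' : ↥(pbox (fine Lc M')) × Fin (3 + 1), Q₁₁ h a b' * h b') * tdelta M' ((a.1 : Site (3 + 1)) + unitVec a.2) t.1)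
      = (∑ a' : ↥(pbox M') × Fin (3 + 1), ((stepScale 3 Lc (j + 1) / (stepScale 3 Lc j ^ 2 * ((box (3 + 1) Lc).card : ℝ))) * ∑ b' : ↥(pbox (fine Lc M')) × Fin (3 + 1), Q₁₁ h a' b' * h b') •
          (perF M' (dper M' (symVhSAt (ctr (3 + 1) Lc) 3 Lc rfl a'.2 (a'.1 : Site (3 + 1))))).submatrix (fun a : κI => ((pμ' a, Sum.inr (mμ' a)) : Idx M' (Fib 3)))
            (fun b : ↥(pbox M') × Fin (3 + 1) => ((b.1, Sum.inl b.2) : Idx M' (Fib 3)))) * Dbar :=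
  torus_Q20_mul_tipRow_eq_member_mul_Dbar M' hM' j pμ' mμ' hQ₂₀ hDbar (fun a => ∑ b' : ↥(pbox (fine Lc M')) × Fin (3 + 1), Q₁₁ h a b' * h b')

/-! ## §3 Row `d2` in U21's displayed shape, for the pure bi-member -/

/-- [folklore] additive cancellation used by `torus_d2_sym_bimember`: `(P + M) + B + C = R` and `R = M` give `P + B + C = 0`. -/
theorem add_cancel_of_eq {α : Type*} [AddCommGroup α] {P M B C R : α} (h₁ : P + M + B + C = R) (h₂ : R = M) : P + B + C = 0 := by
  rw [h₂] at h₁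
  have e : P + B + C = P + M + B + C - M := by abel
  rw [e, h₁, sub_self]

/-- [folklore] **ROW `d2` OF THE (STEP) DOOR AT THE TORUS, VERBATIM, FOR THE PURE BI-MEMBER** (RULING R-FP-63 (i), cut (B)).  T4's object binders VERBATIM
(`hQ₂₀ hQ₂₁ hW₂₂ hDbar hDb₁ hDb₂`, any bond weight `h`, level `j`, `Q₁₀ Q₁₁` FREE) except that the order-2 coarse insertion table is the PURE BI-MEMBER
`Q₂₂′ w w′ := −c_{j+1} • Σ_{a′,a″} (w̄ a′·w̄′ a″) • Q₂₂mem^{a′,a″}` (`hQ₂₂′` = the FIRST summand of U21's `hQ₂₂`, the average map's second-jet member left out):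
`Q₂₂′ h h * Dbar + 2 • (Q₂₁ h * Db₁) + Q₂₀ * Db₂ = 0` with the PURE `Db₂ = c_j³·((Q₁₀ h) a)²·[t̄ = tip a]` of row `c2`.  Proof: T4 at `Q₂₂ := Q₂₂′ + Q₂₂″`, then §2. -/
theorem torus_d2_sym_bimember (hM' : ∀ i, Lc ∣ M' i) (j : ℕ) {κI : Type*} (pμ' : κI → ↥(pbox M')) (mμ' : κI → Fin (3 + 1))
    (h : ↥(pbox (fine Lc M')) × Fin (3 + 1) → ℝ)
    (Q₁₀ : Matrix (↥(pbox M') × Fin (3 + 1)) (↥(pbox (fine Lc M')) × Fin (3 + 1)) ℝ)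
    (Q₁₁ : (↥(pbox (fine Lc M')) × Fin (3 + 1) → ℝ) → Matrix (↥(pbox M') × Fin (3 + 1)) (↥(pbox (fine Lc M')) × Fin (3 + 1)) ℝ)
    {Q₂₀ : Matrix κI (↥(pbox M') × Fin (3 + 1)) ℝ}
    (hQ₂₀ : Q₂₀ = (perF M' (bhKStepSh 3 Lc (Dsh Lc) (j + 1))).submatrix (fun a : κI => ((pμ' a, Sum.inr (mμ' a)) : Idx M' (Fib 3)))
        (fun b : ↥(pbox M') × Fin (3 + 1) => ((b.1, Sum.inl b.2) : Idx M' (Fib 3))))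
    (Q₂₁ : (↥(pbox (fine Lc M')) × Fin (3 + 1) → ℝ) → Matrix κI (↥(pbox M') × Fin (3 + 1)) ℝ)
    (hQ₂₁ : ∀ w, Q₂₁ w = ∑ b : ↥(pbox (fine Lc M')) × Fin (3 + 1), w b •
        ∑ a' : ↥(pbox M') × Fin (3 + 1), ((stepScale 3 Lc (j + 1) / (stepScale 3 Lc j ^ 2 * ((box (3 + 1) Lc).card : ℝ))) * Q₁₀ a' b) •
          (perF M' (dper M' (symVhSAt (ctr (3 + 1) Lc) 3 Lc rfl a'.2 (a'.1 : Site (3 + 1))))).submatrix (fun a : κI => ((pμ' a, Sum.inr (mμ' a)) : Idx M' (Fib 3)))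
            (fun b : ↥(pbox M') × Fin (3 + 1) => ((b.1, Sum.inl b.2) : Idx M' (Fib 3))))
    {W₂₂ : Fin (3 + 1) → Site (3 + 1) → Fin (3 + 1) → Site (3 + 1) → MKer (3 + 1) (Fib 3)}
    (hW₂₂ : W₂₂ = fun κ' u' κ u x z a c => ∑' n : Site (3 + 1), symVh₂SAn1 3 Lc κ u κ' (translate M' u' n) x z a c)
    (Q₂₂' : (↥(pbox (fine Lc M')) × Fin (3 + 1) → ℝ) → (↥(pbox (fine Lc M')) × Fin (3 + 1) → ℝ) → Matrix κI (↥(pbox M') × Fin (3 + 1)) ℝ)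
    (hQ₂₂' : ∀ w w', Q₂₂' w w' = -(((Lc : ℝ) ^ (3 + 1) * stepScale 3 Lc (j + 1))⁻¹) • (∑ a' : ↥(pbox M') × Fin (3 + 1), ∑ a'' : ↥(pbox M') × Fin (3 + 1),
          (((stepScale 3 Lc (j + 1) / (stepScale 3 Lc j ^ 2 * ((box (3 + 1) Lc).card : ℝ))) * ∑ b : ↥(pbox (fine Lc M')) × Fin (3 + 1), Q₁₀ a' b * w b) * ((stepScale 3 Lc (j + 1) / (stepScale 3 Lc j ^ 2 * ((box (3 + 1) Lc).card : ℝ))) * ∑ b : ↥(pbox (fine Lc M')) × Fin (3 + 1), Q₁₀ a'' b * w' b)) •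
            (perF M' (dper M' (W₂₂ a''.2 (a''.1 : Site (3 + 1)) a'.2 (a'.1 : Site (3 + 1))))).submatrix (fun a : κI => ((pμ' a, Sum.inr (mμ' a)) : Idx M' (Fib 3)))
            (fun b : ↥(pbox M') × Fin (3 + 1) => ((b.1, Sum.inl b.2) : Idx M' (Fib 3)))))
    {Dbar : Matrix (↥(pbox M') × Fin (3 + 1)) (Res (ctr (3 + 1) Lc) Lc M') ℝ}
    (hDbar : Dbar = Matrix.of fun (a : ↥(pbox M') × Fin (3 + 1)) (t : Res (ctr (3 + 1) Lc) Lc M') =>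
        stepScale 3 Lc j * (((box (3 + 1) Lc).card : ℝ) * tgrad M' (a.1, Sum.inl a.2) t.1))
    {Db₁ : Matrix (↥(pbox M') × Fin (3 + 1)) (Res (ctr (3 + 1) Lc) Lc M') ℝ}
    (hDb₁ : Db₁ = ∑ b : ↥(pbox (fine Lc M')) × Fin (3 + 1), h b •
        Matrix.of fun (a : ↥(pbox M') × Fin (3 + 1)) (t : Res (ctr (3 + 1) Lc) Lc M') =>
          -((((Lc : ℝ) ^ (3 + 1) * stepScale 3 Lc j)⁻¹) * Q₁₀ a b * tdelta M' ((a.1 : Site (3 + 1)) + unitVec a.2) t.1))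
    {Db₂ : Matrix (↥(pbox M') × Fin (3 + 1)) (Res (ctr (3 + 1) Lc) Lc M') ℝ}
    (hDb₂ : Db₂ = Matrix.of fun (a : ↥(pbox M') × Fin (3 + 1)) (t : Res (ctr (3 + 1) Lc) Lc M') =>
        (((Lc : ℝ) ^ (3 + 1) * stepScale 3 Lc j)⁻¹) ^ 3 * (∑ b : ↥(pbox (fine Lc M')) × Fin (3 + 1), Q₁₀ a b * h b) ^ 2 * tdelta M' ((a.1 : Site (3 + 1)) + unitVec a.2) t.1) :
    Q₂₂' h h * Dbar + (2 : ℝ) • (Q₂₁ h * Db₁) + Q₂₀ * Db₂ = 0 := by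
  -- T4 at the FULL table `Q₂₂ := Q₂₂′ + Q₂₂″`
  have hT4 := torus_d2_sym_weighted M' hM' j pμ' mμ' h Q₁₀ Q₁₁ hQ₂₀ Q₂₁ hQ₂₁ hW₂₂
    (fun w w' => Q₂₂' w w'
      + ∑ a' : ↥(pbox M') × Fin (3 + 1), ((stepScale 3 Lc (j + 1) / (stepScale 3 Lc j ^ 2 * ((box (3 + 1) Lc).card : ℝ))) * ∑ b' : ↥(pbox (fine Lc M')) × Fin (3 + 1), Q₁₁ w a' b' * w' b') •
          (perF M' (dper M' (symVhSAt (ctr (3 + 1) Lc) 3 Lc rfl a'.2 (a'.1 : Site (3 + 1))))).submatrix (fun a : κI => ((pμ' a, Sum.inr (mμ' a)) : Idx M' (Fib 3)))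
            (fun b : ↥(pbox M') × Fin (3 + 1) => ((b.1, Sum.inl b.2) : Idx M' (Fib 3))))
    (fun w w' => by simp only [hQ₂₂']) hDbar hDb₁ hDb₂
  -- split `(Q₂₂′ + Q₂₂″)·D̄` and cancel the member with §2
  rw [Matrix.add_mul] at hT4
  exact add_cancel_of_eq hT4 (torus_Q20_mul_Db2'_eq_member_mul_Dbar M' hM' j pμ' mμ' h Q₁₁ hQ₂₀ hDbar)

end Summit.QuantumFields.BalabanUV.Beta.FP.PeriodisedSymCoarseWardBiMember

end
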